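import Summits.CriticalPhenomena.Ising3D.ExclusionSentences
import Mathlib.Analysis.Real.Pi.Bounds
import Mathlib.Analysis.Complex.ExponentialBounds

/-!
# Exclusion sentences — the `π` / `log 2` / `e` parts of families `LIN` and `TRG` in kernel form
(cell `pub-ising3x`, seat recog-1)

HONEST FRAMING: lottery ticket; floor = tightest certified 3D Ising CFT bounds; no exact-solution
claim without a proof.

Families `LIN` and `TRG` of the frozen list FAMILIES-v1 (`HOME/frozen/FAMILIES-v1.json` b39f709f…,
SCOPE.md §3.1) are built on transcendental constants; the recogniser decides membership with exactrec's
certified balls and SCOPE §3 records them as "reported, never kernel-checked". Mathlib certifies three of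
the constants to many digits — `π` (`Real.pi_gt_d20` / `Real.pi_lt_d20`, 20 digits), `log 2`
(`Real.log_two_near_10`), `e` (`Real.exp_one_gt_d9` / `Real.exp_one_lt_d9`) — and `√2`, `√3`, `√π` follow by
squaring. This file gives kernel-checkable exclusion sentences for the sub-families that use only those:
* `TRGπ` ⊂ TRG: `x = (p/q) · u · π^(a/2) · L^s`, `u ∈ {1, √2, √3}`, `a ∈ [−6, 6]`, `L ∈ {log 2, e}`,
  `s ∈ {−1, 0, 1}`, `(a, s) ≠ (0, 0)`, `1 ≤ p, q ≤ h` (the TRG members with no `Γ(¼)`, `Γ(⅓)`, `ζ(3)`,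
  `ζ(5)`, `G` factor; grading `D = |a| + 2|s| + [u ≠ 1]`, `h = max(p, q)` as in FAMILIES-v1):
  `trgPiFamily D h`, checker `trgPiExcluded D h a b ex`, `trgPiExcluded_sound`;
* `LINπ` ⊂ LIN: `x = (a₀ + c₁π + c₂π² + c₃π³ + c₄ log 2)/aₓ`, at most two of `c₁…c₄` non-zero, not all
  zero, `|cᵢ| ≤ H`, `1 ≤ aₓ ≤ H`, `a₀ ∈ ℤ` free (the LIN members avoiding `ζ(3)`, `ζ(5)`, `G`):
  `linPiFamily H`, checker `linPiExcluded H a b ex`, `linPiExcluded_sound`;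
* bridges `sigma_trgPi_covered_of_isingEnclosure`, `sigma_linPi_covered_of_isingEnclosure` (+ `eps_…`).
Semantics of `= true` (soundness theorems): every member of the sub-family in `[a, b]` EQUALS the value of
a listed tuple — the recogniser's member list for these forms, certified complete by the kernel. The
rational interval arithmetic (`InI`, `mulI`, `invI`, `powI`, `zpowI`, `smulI`, `addI`) is proved sound
once; the base enclosures `piI`, `sqrtPiI`, `sqrt2I`, `sqrt3I`, `log2I`, `eI` are discharged from the
Mathlib lemmas above. Undecidable edge cases (a member within the enclosure slack — `2·10⁻¹⁰` relative for
`log 2`/`e` forms, `10⁻¹⁹` for pure `π` forms — of an endpoint) are simply required to be listed. The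
`ζ(3)`, `ζ(5)`, Catalan and `Γ` parts of LIN/TRG stay exactrec-reported (no Mathlib enclosure exists).
No 3D digit is used; 2D-control / validation instances live in `ExclusionSentencesControl2DPi.lean`.
-/

namespace Summit.CriticalPhenomena.Ising3D

open Literature.MathematicalPhysics.QuantumFieldTheory.ConformalBootstrap3D

/-! ### Rational interval arithmetic (closed intervals as pairs `(lo, hi)`) -/

/-- `InI I`: the closed real interval with the rational end points `I = (lo, hi)`. -/
abbrev InI (I : ℚ × ℚ) : Set ℝ := Set.Icc ((I.1 : ℚ) : ℝ) ((I.2 : ℚ) : ℝ)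

/-- Product of two intervals with non-negative lower ends. -/
def mulI (I J : ℚ × ℚ) : ℚ × ℚ := (I.1 * J.1, I.2 * J.2)

/-- Soundness of `mulI` (non-negative factors). -/
theorem mulI_sound {I J : ℚ × ℚ} {x y : ℝ} (hI : 0 ≤ I.1) (hJ : 0 ≤ J.1) (hx : x ∈ InI I)
    (hy : y ∈ InI J) : x * y ∈ InI (mulI I J) := by
  obtain ⟨hx1, hx2⟩ := hx
  obtain ⟨hy1, hy2⟩ := hy
  have hI' : (0 : ℝ) ≤ I.1 := by exact_mod_cast hI
  have hJ' : (0 : ℝ) ≤ J.1 := by exact_mod_cast hJ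
  refine ⟨?_, ?_⟩
  · simp only [mulI, Rat.cast_mul]; exact mul_le_mul hx1 hy1 hJ' (hI'.trans hx1)
  · simp only [mulI, Rat.cast_mul]
    exact mul_le_mul hx2 hy2 (hJ'.trans hy1) ((hI'.trans hx1).trans hx2)

/-- Reciprocal of an interval with positive lower end. -/
def invI (I : ℚ × ℚ) : ℚ × ℚ := (I.2⁻¹, I.1⁻¹)

/-- Soundness of `invI`. -/
theorem invI_sound {I : ℚ × ℚ} {x : ℝ} (hI : 0 < I.1) (hx : x ∈ InI I) : x⁻¹ ∈ InI (invI I) := by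
  obtain ⟨hx1, hx2⟩ := hx
  have hI' : (0 : ℝ) < I.1 := by exact_mod_cast hI
  have hx0 : 0 < x := hI'.trans_le hx1
  refine ⟨?_, ?_⟩
  · simp only [invI, Rat.cast_inv]; exact inv_anti₀ hx0 hx2
  · simp only [invI, Rat.cast_inv]; exact inv_anti₀ hI' hx1

/-- Natural power of an interval with non-negative lower end. -/
def powI (I : ℚ × ℚ) (n : ℕ) : ℚ × ℚ := (I.1 ^ n, I.2 ^ n)

/-- Soundness of `powI`. -/
theorem powI_sound {I : ℚ × ℚ} {x : ℝ} (hI : 0 ≤ I.1) (hx : x ∈ InI I) (n : ℕ) :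
    x ^ n ∈ InI (powI I n) := by
  obtain ⟨hx1, hx2⟩ := hx
  have hI' : (0 : ℝ) ≤ I.1 := by exact_mod_cast hI
  refine ⟨?_, ?_⟩
  · simp only [powI, Rat.cast_pow]; exact pow_le_pow_left₀ hI' hx1 n
  · simp only [powI, Rat.cast_pow]; exact pow_le_pow_left₀ (hI'.trans hx1) hx2 n

/-- Integer power of an interval with positive lower end. -/
def zpowI (I : ℚ × ℚ) (a : ℤ) : ℚ × ℚ :=
  if 0 ≤ a then powI I a.toNat else invI (powI I (-a).toNat)

/-- The lower end of `zpowI` stays positive. -/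
theorem zpowI_pos {I : ℚ × ℚ} (h1 : 0 < I.1) (h2 : 0 < I.2) (a : ℤ) : 0 < (zpowI I a).1 := by
  unfold zpowI powI invI
  split_ifs
  · exact pow_pos h1 _
  · simp only [inv_pos]; exact pow_pos h2 _

/-- Soundness of `zpowI`. -/
theorem zpowI_sound {I : ℚ × ℚ} {x : ℝ} (hI : 0 < I.1) (hx : x ∈ InI I) (a : ℤ) :
    x ^ a ∈ InI (zpowI I a) := by
  unfold zpowI
  split_ifs with ha
  · have e : x ^ a = x ^ a.toNat := by
      rw [← zpow_natCast]; congr 1; exact (Int.toNat_of_nonneg ha).symm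
    rw [e]; exact powI_sound hI.le hx _
  · have e : x ^ a = (x ^ (-a).toNat)⁻¹ := by
      rw [← zpow_natCast, ← zpow_neg]; congr 1
      have := Int.toNat_of_nonneg (show 0 ≤ -a by omega); omega
    rw [e]
    exact invI_sound (by simp only [powI]; exact pow_pos hI _) (powI_sound hI.le hx _)

/-- Integer multiple of an interval (either sign). -/
def smulI (k : ℤ) (I : ℚ × ℚ) : ℚ × ℚ :=
  if 0 ≤ k then ((k : ℚ) * I.1, (k : ℚ) * I.2) else ((k : ℚ) * I.2, (k : ℚ) * I.1)

/-- Soundness of `smulI`. -/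
theorem smulI_sound (k : ℤ) {I : ℚ × ℚ} {x : ℝ} (hx : x ∈ InI I) : (k : ℝ) * x ∈ InI (smulI k I) := by
  obtain ⟨hx1, hx2⟩ := hx
  unfold smulI
  split_ifs with hk
  · have hk' : (0 : ℝ) ≤ k := by exact_mod_cast hk
    refine ⟨?_, ?_⟩
    · simp only [Rat.cast_mul, Rat.cast_intCast]; exact mul_le_mul_of_nonneg_left hx1 hk'
    · simp only [Rat.cast_mul, Rat.cast_intCast]; exact mul_le_mul_of_nonneg_left hx2 hk'
  · have hk' : (k : ℝ) ≤ 0 := by exact_mod_cast (le_of_lt (not_le.mp hk))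
    refine ⟨?_, ?_⟩
    · simp only [Rat.cast_mul, Rat.cast_intCast]; exact mul_le_mul_of_nonpos_left hx2 hk'
    · simp only [Rat.cast_mul, Rat.cast_intCast]; exact mul_le_mul_of_nonpos_left hx1 hk'

/-- Sum of two intervals. -/
def addI (I J : ℚ × ℚ) : ℚ × ℚ := (I.1 + J.1, I.2 + J.2)

/-- Soundness of `addI`. -/
theorem addI_sound {I J : ℚ × ℚ} {x y : ℝ} (hx : x ∈ InI I) (hy : y ∈ InI J) : x + y ∈ InI (addI I J) := by
  obtain ⟨hx1, hx2⟩ := hx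
  obtain ⟨hy1, hy2⟩ := hy
  refine ⟨?_, ?_⟩
  · simp only [addI, Rat.cast_add]; exact add_le_add hx1 hy1
  · simp only [addI, Rat.cast_add]; exact add_le_add hx2 hy2

/-! ### Base enclosures from Mathlib's certified digits -/

/-- `π ∈ [3.14159265358979323846, 3.14159265358979323847]` (`Real.pi_gt_d20`, `Real.pi_lt_d20`). -/
def piI : ℚ × ℚ := (314159265358979323846 / 10 ^ 20, 314159265358979323847 / 10 ^ 20)

/-- Soundness of `piI`. -/
theorem pi_mem_piI : Real.pi ∈ InI piI := by
  have h1 := Real.pi_gt_d20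
  have h2 := Real.pi_lt_d20
  refine ⟨?_, ?_⟩
  · simp only [piI]; push_cast; norm_num at h1 ⊢; linarith
  · simp only [piI]; push_cast; norm_num at h2 ⊢; linarith

/-- `√π ∈ [1.7724538509055160272, 1.7724538509055160274]` (squares enclose `piI`). -/
def sqrtPiI : ℚ × ℚ := (17724538509055160272 / 10 ^ 19, 17724538509055160274 / 10 ^ 19)

/-- Soundness of `sqrtPiI`. -/
theorem sqrtPi_mem_sqrtPiI : Real.sqrt Real.pi ∈ InI sqrtPiI := by
  have h1 := Real.pi_gt_d20
  have h2 := Real.pi_lt_d20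
  refine ⟨?_, ?_⟩
  · simp only [sqrtPiI]; push_cast
    rw [show ((17724538509055160272 : ℝ) / 10 ^ 19) = Real.sqrt (((17724538509055160272 : ℝ) / 10 ^ 19) ^ 2)
      from (Real.sqrt_sq (by positivity)).symm]
    exact Real.sqrt_le_sqrt (by norm_num at h1 ⊢; linarith)
  · simp only [sqrtPiI]; push_cast
    rw [show ((17724538509055160274 : ℝ) / 10 ^ 19) = Real.sqrt (((17724538509055160274 : ℝ) / 10 ^ 19) ^ 2)
      from (Real.sqrt_sq (by positivity)).symm]
    exact Real.sqrt_le_sqrt (by norm_num at h2 ⊢; linarith)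

/-- `√2 ∈ [1.4142135623730950488, 1.41421356237309504881]`. -/
def sqrt2I : ℚ × ℚ := (141421356237309504880 / 10 ^ 20, 141421356237309504881 / 10 ^ 20)

/-- Soundness of `sqrt2I`. -/
theorem sqrt2_mem_sqrt2I : Real.sqrt 2 ∈ InI sqrt2I := by
  refine ⟨?_, ?_⟩
  · simp only [sqrt2I]; push_cast
    rw [show ((141421356237309504880 : ℝ) / 10 ^ 20) = Real.sqrt (((141421356237309504880 : ℝ) / 10 ^ 20) ^ 2)
      from (Real.sqrt_sq (by positivity)).symm]
    exact Real.sqrt_le_sqrt (by norm_num)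
  · simp only [sqrt2I]; push_cast
    rw [show ((141421356237309504881 : ℝ) / 10 ^ 20) = Real.sqrt (((141421356237309504881 : ℝ) / 10 ^ 20) ^ 2)
      from (Real.sqrt_sq (by positivity)).symm]
    exact Real.sqrt_le_sqrt (by norm_num)

/-- `√3 ∈ [1.73205080756887729352, 1.73205080756887729353]`. -/
def sqrt3I : ℚ × ℚ := (173205080756887729352 / 10 ^ 20, 173205080756887729353 / 10 ^ 20)

/-- Soundness of `sqrt3I`. -/
theorem sqrt3_mem_sqrt3I : Real.sqrt 3 ∈ InI sqrt3I := by
  refine ⟨?_, ?_⟩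
  · simp only [sqrt3I]; push_cast
    rw [show ((173205080756887729352 : ℝ) / 10 ^ 20) = Real.sqrt (((173205080756887729352 : ℝ) / 10 ^ 20) ^ 2)
      from (Real.sqrt_sq (by positivity)).symm]
    exact Real.sqrt_le_sqrt (by norm_num)
  · simp only [sqrt3I]; push_cast
    rw [show ((173205080756887729353 : ℝ) / 10 ^ 20) = Real.sqrt (((173205080756887729353 : ℝ) / 10 ^ 20) ^ 2)
      from (Real.sqrt_sq (by positivity)).symm]
    exact Real.sqrt_le_sqrt (by norm_num)

/-- `log 2 ∈ [287209/414355 − 10⁻¹⁰, 287209/414355 + 10⁻¹⁰]` (`Real.log_two_near_10`). -/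
def log2I : ℚ × ℚ := (287209 / 414355 - 1 / 10 ^ 10, 287209 / 414355 + 1 / 10 ^ 10)

/-- Soundness of `log2I`. -/
theorem log2_mem_log2I : Real.log 2 ∈ InI log2I := by
  have h := abs_le.mp Real.log_two_near_10
  refine ⟨?_, ?_⟩
  · simp only [log2I]; push_cast; linarith [h.1]
  · simp only [log2I]; push_cast; linarith [h.2]

/-- `e ∈ [2.7182818283, 2.7182818286]` (`Real.exp_one_gt_d9`, `Real.exp_one_lt_d9`). -/
def eI : ℚ × ℚ := (27182818283 / 10 ^ 10, 27182818286 / 10 ^ 10)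

/-- Soundness of `eI`. -/
theorem e_mem_eI : Real.exp 1 ∈ InI eI := by
  have h1 := Real.exp_one_gt_d9
  have h2 := Real.exp_one_lt_d9
  refine ⟨?_, ?_⟩
  · simp only [eI]; push_cast; norm_num at h1 ⊢; linarith
  · simp only [eI]; push_cast; norm_num at h2 ⊢; linarith

/-! ### Family `TRGπ`: `(p/q) · u · π^(a/2) · L^s` -/

/-- Enclosure of `u ∈ {1, √2, √3}` (index `0, 1, 2`). -/
def uI : ℕ → ℚ × ℚ
  | 1 => sqrt2I
  | 2 => sqrt3I
  | _ => (1, 1)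

/-- The value `u ∈ {1, √2, √3}` (index `0, 1, 2`; any other index means `1`). -/
noncomputable def uVal : ℕ → ℝ
  | 1 => Real.sqrt 2
  | 2 => Real.sqrt 3
  | _ => 1

/-- Enclosure of `L ∈ {log 2, e}` (index `0, 1`). -/
def lI : ℕ → ℚ × ℚ
  | 0 => log2I
  | _ => eI

/-- The value `L ∈ {log 2, e}` (index `0`: `log 2`; otherwise `e`). -/
noncomputable def lVal : ℕ → ℝ
  | 0 => Real.log 2
  | _ => Real.exp 1

/-- The TRG monomial `u · (√π)^a · L^s` (`a, s ∈ ℤ`; `(√π)^a = π^(a/2)`). -/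
noncomputable def trgVal (u : ℕ) (a : ℤ) (L : ℕ) (s : ℤ) : ℝ :=
  uVal u * Real.sqrt Real.pi ^ a * lVal L ^ s

/-- Rational enclosure of `trgVal u a L s`. -/
def trgEncl (u : ℕ) (a : ℤ) (L : ℕ) (s : ℤ) : ℚ × ℚ :=
  mulI (mulI (uI u) (zpowI sqrtPiI a)) (zpowI (lI L) s)

/-- Soundness of `uI`, and positivity of its lower end. -/
theorem uVal_mem (u : ℕ) : uVal u ∈ InI (uI u) ∧ 0 < (uI u).1 := by
  match u with
  | 0 => exact ⟨by simp [uI, uVal, InI], by simp [uI]⟩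
  | 1 => exact ⟨sqrt2_mem_sqrt2I, by norm_num [uI, sqrt2I]⟩
  | 2 => exact ⟨sqrt3_mem_sqrt3I, by norm_num [uI, sqrt3I]⟩
  | n + 3 => exact ⟨by simp [uI, uVal, InI], by simp [uI]⟩

/-- Soundness of `lI`, and positivity of both ends. -/
theorem lVal_mem (L : ℕ) : lVal L ∈ InI (lI L) ∧ 0 < (lI L).1 ∧ 0 < (lI L).2 := by
  match L with
  | 0 => exact ⟨log2_mem_log2I, by norm_num [lI, log2I], by norm_num [lI, log2I]⟩
  | n + 1 => exact ⟨e_mem_eI, by norm_num [lI, eI], by norm_num [lI, eI]⟩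

/-- Soundness of `trgEncl`, and positivity of its lower end. -/
theorem trgVal_mem (u : ℕ) (a : ℤ) (L : ℕ) (s : ℤ) :
    trgVal u a L s ∈ InI (trgEncl u a L s) ∧ 0 < (trgEncl u a L s).1 := by
  obtain ⟨hu, hu0⟩ := uVal_mem u
  obtain ⟨hl, hl1, hl2⟩ := lVal_mem L
  have hsp : 0 < sqrtPiI.1 := by norm_num [sqrtPiI]
  have hsp2 : 0 < sqrtPiI.2 := by norm_num [sqrtPiI]
  have h1 := zpowI_sound hsp sqrtPi_mem_sqrtPiI a
  have h1p := zpowI_pos hsp hsp2 a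
  have h2 := zpowI_sound hl1 hl s
  have h2p := zpowI_pos hl1 hl2 s
  refine ⟨mulI_sound (by simp only [mulI]; positivity) h2p.le (mulI_sound hu0.le h1p.le hu h1) h2, ?_⟩
  simp only [trgEncl, mulI]
  positivity

/-- `trgPiFamily D h` = the TRG members with no `Γ`/`ζ`/Catalan factor: `(p/q) · u · π^(a/2) · L^s`,
`1 ≤ p, q ≤ h`, `u ∈ {1, √2, √3}` (index `≤ 2`), `a ∈ [−6, 6]`, `L ∈ {log 2, e}` (index `≤ 1`),
`s ∈ [−1, 1]`, `(a, s) ≠ (0, 0)`, complexity `|a| + 2|s| + [u ≠ 1] ≤ D` (FAMILIES-v1 TRG with `b = c = 0`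
and `L ∈ {log 2, e}`; `p/q` need not be reduced — a superset). -/
def trgPiFamily (D h : ℕ) : Set ℝ :=
  {x | ∃ (p q u L : ℕ) (a s : ℤ), 1 ≤ p ∧ p ≤ h ∧ 1 ≤ q ∧ q ≤ h ∧ u ≤ 2 ∧ L ≤ 1 ∧ -6 ≤ a ∧ a ≤ 6 ∧
    -1 ≤ s ∧ s ≤ 1 ∧ (a ≠ 0 ∨ s ≠ 0) ∧ a.natAbs + 2 * s.natAbs + (if u = 0 then 0 else 1) ≤ D ∧
    x = (p : ℝ) / q * trgVal u a L s}

/-- A listed TRG tuple `(p, q, u, a, L, s)` and its value. -/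
noncomputable def trgTupleVal (e : ℕ × ℕ × ℕ × ℤ × ℕ × ℤ) : ℝ :=
  (e.1 : ℝ) / e.2.1 * trgVal e.2.2.1 e.2.2.2.1 e.2.2.2.2.1 e.2.2.2.2.2

/-- One `(p, q)` candidate for a fixed monomial with enclosure `m`: decidably outside `[a, b]`
(`(p/q)·m.hi < a` or `b < (p/q)·m.lo`), or listed with the same monomial and `p·q′ = p′·q`. -/
def trgCandOK (a b : ℚ) (ex : List (ℕ × ℕ × ℕ × ℤ × ℕ × ℤ)) (u : ℕ) (av : ℤ) (L : ℕ) (s : ℤ)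
    (m : ℚ × ℚ) (q : ℕ) (p : ℤ) : Bool :=
  decide ((p : ℚ) / q * m.2 < a) || decide (b < (p : ℚ) / q * m.1) ||
    ex.any fun e => decide (0 < e.2.1 ∧ e.2.2.1 = u ∧ e.2.2.2.1 = av ∧ e.2.2.2.2.1 = L ∧ e.2.2.2.2.2 = s ∧
      p * (e.2.1 : ℤ) = (e.1 : ℤ) * q)

/-- The TRGπ checker: loops `u ≤ 2`, `a ∈ [−6, 6]`, `L ≤ 1`, `s ∈ [−1, 1]` (skipping `(a,s) = (0,0)`, the
duplicate `L = e` when `s = 0`, and tuples above the complexity bound), `q ∈ [1, h]`, and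
`p ∈ [max 1 ⌈a q / m.hi⌉, min h ⌊b q / m.lo⌋]` for the monomial enclosure `m`. -/
def trgPiExcluded (D h : ℕ) (a b : ℚ) (ex : List (ℕ × ℕ × ℕ × ℤ × ℕ × ℤ)) : Bool :=
  (List.range 3).all fun u =>
    allIntIcc (-6) 6 fun av =>
      (List.range 2).all fun L =>
        allIntIcc (-1) 1 fun s =>
          decide (av = 0 ∧ s = 0) || decide (s = 0 ∧ L = 1) ||
            !decide (av.natAbs + 2 * s.natAbs + (if u = 0 then 0 else 1) ≤ D) ||
            (List.range' 1 h).all fun q =>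
              allIntIcc (max 1 ⌈a * q / (trgEncl u av L s).2⌉) (min (h : ℤ) ⌊b * q / (trgEncl u av L s).1⌋)
                (trgCandOK a b ex u av L s (trgEncl u av L s) q)

/-- **Soundness of the TRGπ sentence.** If `trgPiExcluded D h a b ex = true` then every member of
`trgPiFamily D h` in `[a, b]` equals the value of a listed tuple. -/
theorem trgPiExcluded_sound {D h : ℕ} {a b : ℚ} {ex : List (ℕ × ℕ × ℕ × ℤ × ℕ × ℤ)}
    (hc : trgPiExcluded D h a b ex = true) {x : ℝ} (hx : (a : ℝ) ≤ x ∧ x ≤ b)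
    (hmem : x ∈ trgPiFamily D h) : ∃ e ∈ ex, x = trgTupleVal e := by
  obtain ⟨p, q, u, L₀, av, s, hp1, hph, hq1, hqh, hu, hL₀, ha1, ha2, hs1, hs2, hne, hD, rfl⟩ := hmem
  -- when `s = 0` the constant `L` plays no role: normalise to `L = 0` (the checker skips the duplicate)
  obtain ⟨L, hL, hskip, hval⟩ : ∃ L, L ≤ 1 ∧ ¬(s = 0 ∧ L = 1) ∧ trgVal u av L₀ s = trgVal u av L s := by
    by_cases hs : s = 0
    · exact ⟨0, by omega, by omega, by simp [trgVal, hs]⟩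
    · exact ⟨L₀, hL₀, by omega, rfl⟩
  rw [hval] at hx ⊢
  obtain ⟨⟨hm1, hm2⟩, hm0⟩ := trgVal_mem u av L s
  set m := trgEncl u av L s with hm
  have hm0' : (0 : ℝ) < m.1 := by exact_mod_cast hm0
  have hmv : 0 < trgVal u av L s := hm0'.trans_le hm1
  have hq0 : (0 : ℝ) < q := by exact_mod_cast hq1
  have hpq0 : (0 : ℝ) < (p : ℝ) / q := by positivity
  unfold trgPiExcluded at hc
  have h1 := List.all_eq_true.mp hc u (List.mem_range.mpr (by omega))
  have h2 := allIntIcc_sound h1 ha1 ha2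
  have h3 := List.all_eq_true.mp h2 L (List.mem_range.mpr (by omega))
  have h4 := allIntIcc_sound h3 hs1 hs2
  simp only [Bool.or_eq_true, decide_eq_true_eq, Bool.not_eq_true', decide_eq_false_iff_not] at h4
  rcases h4 with ((h4 | h4) | h4) | h4
  · omega
  · exact absurd h4 hskip
  · exact absurd hD h4
  · have h5 := List.all_eq_true.mp h4 q (List.mem_range'_1.mpr ⟨hq1, by omega⟩)
    -- the range of `p`
    have hlo : max 1 ⌈a * q / m.2⌉ ≤ (p : ℤ) := by
      refine max_le (by exact_mod_cast hp1) ?_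
      have hm2q : (0 : ℚ) < m.2 := by
        have : (m.1 : ℝ) ≤ m.2 := hm1.trans hm2
        exact lt_of_lt_of_le hm0 (by exact_mod_cast this)
      rw [Int.ceil_le, div_le_iff₀ hm2q]
      have : (a : ℝ) * q ≤ p * m.2 := by
        have := hx.1  -- a ≤ p/q * v ≤ p/q * m.2
        have h' : (p : ℝ) / q * trgVal u av L s ≤ p / q * m.2 := mul_le_mul_of_nonneg_left hm2 hpq0.le
        have h'' : (a : ℝ) ≤ p / q * m.2 := this.trans h'
        calc (a : ℝ) * q ≤ p / q * m.2 * q := mul_le_mul_of_nonneg_right h'' hq0.le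
          _ = p * m.2 := by field_simp
      exact_mod_cast this
    have hhi : (p : ℤ) ≤ min (h : ℤ) ⌊b * q / m.1⌋ := by
      refine le_min (by exact_mod_cast hph) ?_
      rw [Int.le_floor, le_div_iff₀ hm0]
      have : (p : ℝ) * m.1 ≤ b * q := by
        have h' : (p : ℝ) / q * m.1 ≤ p / q * trgVal u av L s := mul_le_mul_of_nonneg_left hm1 hpq0.le
        have h'' : (p : ℝ) / q * m.1 ≤ b := h'.trans hx.2
        calc (p : ℝ) * m.1 = p / q * m.1 * q := by field_simp
          _ ≤ b * q := mul_le_mul_of_nonneg_right h'' hq0.le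
      exact_mod_cast this
    have h6 := allIntIcc_sound h5 hlo hhi
    unfold trgCandOK at h6
    simp only [Bool.or_eq_true, decide_eq_true_eq, List.any_eq_true] at h6
    rcases h6 with (h6 | h6) | ⟨e, he, hkey⟩
    · exfalso
      have h7 : (((p : ℚ) / q * m.2 : ℚ) : ℝ) < (a : ℝ) := Rat.cast_lt.mpr h6
      push_cast at h7
      linarith [mul_le_mul_of_nonneg_left hm2 hpq0.le, hx.1]
    · exfalso
      have h7 : ((b : ℚ) : ℝ) < (((p : ℚ) / q * m.1 : ℚ) : ℝ) := Rat.cast_lt.mpr h6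
      push_cast at h7
      linarith [mul_le_mul_of_nonneg_left hm1 hpq0.le, hx.2]
    · obtain ⟨he0, heu, hea, heL, hes, hpq⟩ := hkey
      refine ⟨e, he, ?_⟩
      unfold trgTupleVal
      rw [heu, hea, heL, hes]
      have he2 : (0 : ℝ) < e.2.1 := by exact_mod_cast he0
      have hpq' : (p : ℝ) * e.2.1 = e.1 * q := by exact_mod_cast hpq
      congr 1
      rw [div_eq_div_iff hq0.ne' he2.ne']
      exact hpq'

end Summit.CriticalPhenomena.Ising3D
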